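import Mathlib.GroupTheory.Index
import Literature.AlgebraicGeometry.ShimuraVarieties.UnitaryBallQuotientDatum
import Literature.AlgebraicGeometry.HodgeTheory.AlgebraicClasses
import Literature.AlgebraicGeometry.HodgeTheory.ComplexConjugation
import Literature.AlgebraicTopology.SingularHomology.FiniteDeckTransferPullback
import Literature.Topology.CoveringSpaces.OrbitQuotientCovering
import HarnessLib

/-!
# Hecke correspondences acting on the cohomology of a compact ball quotient `X(ℂ) ≅ Γ \ 𝔹`

Definition request `defn-heckeCorrespondenceAction` (topic `AlgebraicGeometry/ShimuraVarieties`;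
consumers: crux `MiddleThetaSpan` of route HodgeConjecture/EndoscopicMiddleDegree, lines
`lefschetz-one-rank-down` (which PINS the operators by the identity `q^*(T_g x) = Σⱼ mⱼ^* x` on
finite covers) and `conjugate-dimension-sieve` (`HeckeDatum`), and the Hecke-isotypic decomposition
of `Hᵏ(X(ℂ); ℂ)` deferred by `NumberTheory/Automorphic/HeckeIsotypicComponent`).

Let `D : UnitaryBallQuotientDatum p X` (`X(ℂ) ≅ Γ \ 𝔹`, `Γ ⊂ U(V)(F)` a torsion-free congruence
subgroup, `𝔹` the ball of negative lines of `V_{τ₁}`, file `UnitaryBallQuotientDatum`) and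
`g ∈ U(V)(F)`. The double coset `Γ g Γ = ⊔ⱼ Γ gⱼ` is a finite union of cosets (`U(V)(F)` commensurates
the congruence subgroup `Γ`: Shimura 1971, Ch. 3, §3.1, and §3.3 for the Hecke ring `R(Γ, Δ)`), and the
**Hecke operator** `T_g = T_{ΓgΓ}` acts on functions / forms / cohomology classes on `Γ \ 𝔹` by
`(T_g f)(v) = Σⱼ f(gⱼ v)` (Shimura 1971, §3.4 (3.4.1) on automorphic forms; §8.3 (8.3.1)–(8.3.2) "Action
of double cosets on the cohomology group", `v(γ) = Σᵢ αᵢ^ι u(γᵢ)` over coset representatives — the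
explicit form of restriction to `Γ' = Γ ∩ g⁻¹Γg`, conjugation by `g`, and TRANSFER (corestriction)
back to `Γ`); geometrically `T_g = π_* ∘ π_g^*` for the two finite étale projections
`π, π_g : Γ' \ 𝔹 ⇉ Γ \ 𝔹`, `π[v] = [v]`, `π_g[v] = [g v]`, of the Hecke correspondence, an algebraic
correspondence on `X × X` (Shimura 1971, Ch. 7, §7.2–7.3 for modular curves; BMM arXiv:1306.1515,
Part 2 §1.8: "the Hecke algebra `ℋ_K` acts as algebraic correspondences on `S(K)`", Thm. 61).

## Lean rendering (real carriers, genuine transfer ∘ pull-back; one canonical level)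

The tree's transfer `FiniteDeckCover.transferMap` (`AlgebraicTopology/SingularHomology/
FiniteDeckTransfer`, Hatcher §3.G) is for finite REGULAR covers, so `T_g` is presented on the Galois
cover `N \ 𝔹 → Γ \ 𝔹 = X(ℂ)` of level `N = N_g :=` the normal core in `Γ` of `Γ' = Γ ∩ g⁻¹Γg`
(deck group `Γ / N`), as
`T_g := [Γ' : N]⁻¹ · τ_N ∘ (π_g^N)^*`, `π_g^N [v] = [g v]` — on `Γ`-invariant functions
`τ_N (π_g^N)^* f (v) = Σ_{γ ∈ N\Γ} f(g γ v) = [Γ' : N] Σ_{Γ'γ ∈ Γ'\Γ} f(g γ v)` and `Γ g Γ = ⊔ Γ g γ`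
over `Γ'γ ∈ Γ' \ Γ`, so this is the classical normalised `T_{ΓgΓ} = Σⱼ gⱼ^*`, independent of the
auxiliary level. Everything is built from the datum:

* `D.ball` — the ball `𝔹 = cone / ℂˣ` of negative lines (quotient of the negative cone `D.cone` by
  scalars), with the action of `Γ` (`MulAction ↥D.Γ D.ball`, by homeomorphisms) and the
  uniformization `D.ballUnif : 𝔹 → X(ℂ)`, an open quotient map whose fibres are the `Γ`-orbits
  (`isOpenQuotientMap_ballUnif`, `ballUnif_eq_iff`; all PROVED from the fields of `D`);
* `D.LevelCover N` (`N : Subgroup ↥D.Γ`) — the level-`N` quotient `N \ 𝔹` (Mathlib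
  `MulAction.orbitRel.Quotient`), its projection `D.levelProj N : N \ 𝔹 → X(ℂ)`, the translated
  projections `D.coverMap N g : [v] ↦ unif (g v)` (`g N g⁻¹ ⊆ Γ`), the deck action of `Γ / N`
  (`Literature/Topology/CoveringSpaces/OrbitQuotientCovering`), transitive on the fibres
  (`exists_smul_of_levelProj_eq`), and the resulting `FiniteDeckCover` structure
  `D.levelDeckCover N hcov` given that `levelProj N` is a covering map;
* `D.heckeStabilizer g = Γ ∩ g⁻¹Γg`, `D.heckeLevel g` (its normal core in `Γ`), `D.heckeIndex g =
  [Γ ∩ g⁻¹Γg : N_g]`, and the ADMISSIBILITY predicate `D.IsHeckeAdmissible g`: `g ∈ U(V)(F)`,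
  `[Γ : N_g] < ∞`, and `N_g \ 𝔹 → X(ℂ)` is a covering map. On paper this holds for EVERY
  `g ∈ U(V)(F)` (finiteness: Shimura 1971 §3.1/§3.3, `U(V)(F)` commensurates `Γ`; covering: `Γ` acts
  freely and properly discontinuously on `𝔹`, so `N \ 𝔹 → Γ \ 𝔹` is a finite Galois covering — with
  the tree's `OrbitQuotient.isQuotientCoveringMap_lift` once proper discontinuity of `Γ` on `D.ball`
  is established); it is PROVED here for `g ∈ Γ` (`isHeckeAdmissible_of_mem`) and is otherwise the
  (genuine, `∀`-free) proof obligation of the consumer — deliberately NOT a named fact (cf. the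
  D-0026 review recorded in `HodgeTheory/CorrespondenceAction`: constructions are not facts);
* **`D.heckeCorrespondenceAction k g : Hᵏ(X(ℂ); ℂ) →ₗ[ℂ] Hᵏ(X(ℂ); ℂ)`** — the Hecke operator
  `T_{ΓgΓ} = [Γ' : N_g]⁻¹ · τ ∘ π_g^*` on `complexBetti X k` when `g` is admissible, and `0` (junk)
  otherwise.

API (all proved): the unfolding `heckeCorrespondenceAction_eq`; **`T_γ = 1` for `γ ∈ Γ`**
(`heckeCorrespondenceAction_of_mem`, in particular `T_1 = 1`: the whole pipeline — level cover,
covering map, transfer — is run, so the definition is not vacuous); the DEFINING IDENTITY on the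
level-`N_g` cover, `π^*(T_g x) = [Γ' : N_g]⁻¹ Σ_{q ∈ Γ/N_g} (π_g ∘ q)^* x`
(`levelProj_map_heckeCorrespondenceAction`, from the general `FiniteDeckCover.map_proj_transferMap`:
`p^* τ^* y = Σ_{q} q^* y`, proved on cochains), with `π_g ∘ (γ N) = (v ↦ unif (g γ v))`
(`coverMap_comp_smul`); and **rationality**: `T_g` preserves `IsRationalClass`
(`isRationalClass_heckeCorrespondenceAction`; the transfer of a `ℚ`-valued cocycle is `ℚ`-valued,
`IsRationalClass.transferMap`). Not here (they are theorems about the datum, filed with the consumer):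
admissibility of every `g ∈ U(V)(F)`, independence of the level and the pinning identity on all deeper
covers, compatibility with Hodge types (the two projections are local biholomorphisms), adjointness
`⟨T_g x, y⟩ = ⟨x, T_{g⁻¹} y⟩`, and the multiplicativity of `g ↦ T_g` (Hecke ring).

## References

* [Shimura1973] G. Shimura, *Introduction to the arithmetic theory of automorphic functions*,
  Publ. Math. Soc. Japan 11, Iwanami Shoten / Princeton UP 1971 (held: Princeton printing): Ch. 3
  (§3.1 Prop. 3.1: `Γ_λ α Γ_μ = ⊔ᵢ Γ_λ αᵢ`, `d = [Γ_μ : Γ_μ ∩ α⁻¹Γ_λα]`, for `α` in the commensurator;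
  §3.3 the Hecke ring of a congruence subgroup; §3.4 (3.4.1) action of double cosets on automorphic
  forms), Ch. 7 (§7.2–7.3 algebraic and modular correspondences), §8.3 (8.3.1)–(8.3.2) (action of
  double cosets on the cohomology group).
* [BergeronMillsonMoeglin2016Balls] N. Bergeron, J. Millson, C. Moeglin, Acta Math. 216 (2016) =
  arXiv:1306.1515, Part 2 §1.8 (Hecke algebra acting by algebraic correspondences), Thm. 61.
* [HatcherAT2002] A. Hatcher, Algebraic Topology, §3.G (transfer for finite covers).
-/

noncomputable section

open CategoryTheory Matrix Topology MulAction
open scoped ComplexOrder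

universe u v w

/-! ### The ball, its level covers, and the Hecke operators -/

namespace Literature.AlgebraicGeometry.ShimuraVarieties

open Literature.AlgebraicGeometry.Motives (SchemeOver ComplexPoints)
open Literature.AlgebraicGeometry.HodgeTheory (complexBetti IsRationalClass)
open Literature.AlgebraicTopology.SingularHomology
open Literature.Topology.CoveringSpaces

/-! #### Rational classes and the transfer -/

-- the cochain modules of `singularCochainComplex` are function types up to unfolding
set_option backward.isDefEq.respectTransparency false in
/-- **The transfer of a rational class is rational**: the transfer of a `ℚ`-valued cocycle,
`(τz)(σ) = Σ_g z(g ∘ σ̃)`, is `ℚ`-valued (the transfer is defined over `ℤ`, Hatcher §3.G). (A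
dot-notation extension of `HodgeTheory.IsRationalClass`, declared here with its absolute name.)
[cite: HatcherAT2002, §3.G p. 321] -/
theorem _root_.Literature.AlgebraicGeometry.HodgeTheory.IsRationalClass.transferMap {G : Type w}
    [Group G] [Fintype G] {E B : Type u} [TopologicalSpace E] [TopologicalSpace B] [MulAction G E]
    (c : FiniteDeckCover G E B) {n : ℕ} {x : singularCohomology ℂ ℂ E n} (hx : IsRationalClass x) :
    IsRationalClass (c.transferMap n x) := by
  obtain ⟨z, rfl, hz⟩ := hx
  refine ⟨HomologicalComplex.cyclesMap c.transfer n z, ?_, fun σ => ?_⟩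
  · change (HomologicalComplex.cyclesMap c.transfer n ≫
      HomologicalComplex.homologyπ (singularCochainComplex ℂ ℂ B) n) z =
      (HomologicalComplex.homologyπ (singularCochainComplex ℂ ℂ E) n ≫
        HomologicalComplex.homologyMap c.transfer n) z
    rw [HomologicalComplex.homologyπ_naturality]
  · have h : singularCochainComplex.iCocycles ℂ ℂ B n (HomologicalComplex.cyclesMap c.transfer n z) =
        c.transfer.f n (singularCochainComplex.iCocycles ℂ ℂ E n z) := by
      change (HomologicalComplex.cyclesMap c.transfer n ≫ HomologicalComplex.iCycles _ n) z =
        (HomologicalComplex.iCycles _ n ≫ c.transfer.f n) z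
      rw [HomologicalComplex.cyclesMap_i]
    rw [h, FiniteDeckCover.transfer_f_apply, FiniteDeckCover.orbitSum]
    have hmem : ∀ g : G, (singularCochainComplex.iCocycles ℂ ℂ E n z)
        ((c.someLift σ).map (c.deck g)) ∈ (algebraMap ℚ ℂ).range := fun g =>
      RingHom.mem_range.2 (hz _)
    exact RingHom.mem_range.1 (Subring.sum_mem _ fun g _ => hmem g)

namespace UnitaryBallQuotientDatum

variable {p : ℕ} {X : SchemeOver ℂ} (D : UnitaryBallQuotientDatum p X)

/-! #### The action of `GL_{p+1}(E)` on `V_{τ₁} = ℂ^{p+1}` -/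

/-- `1` acts trivially. [folklore] -/
theorem act_one (v : Fin (p + 1) → ℂ) : D.act 1 v = v := by
  simp only [UnitaryBallUniformisationDatum.act, Units.val_one,
    Matrix.map_one D.τ₁ (map_zero D.τ₁) (map_one D.τ₁), Matrix.one_mulVec]

/-- `(ab) v = a (b v)`. [folklore] -/
theorem act_mul (a b : GL (Fin (p + 1)) D.E) (v : Fin (p + 1) → ℂ) :
    D.act (a * b) v = D.act a (D.act b v) := by
  simp only [UnitaryBallUniformisationDatum.act, Units.val_mul, Matrix.map_mul, Matrix.mulVec_mulVec]

/-- The action is `ℂ`-linear: `a (c v) = c (a v)`. [folklore] -/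
theorem act_smul (a : GL (Fin (p + 1)) D.E) (c : ℂ) (v : Fin (p + 1) → ℂ) :
    D.act a (c • v) = c • D.act a v :=
  Matrix.mulVec_smul _ _ _

/-- Isometries of `V` preserve the negative cone: `U(V)(F)` acts on the ball (cf. `act_mem_cone`,
the case `γ ∈ Γ`). [cite: BergeronMillsonMoeglin2016Balls, Part 2 §1.3] -/
theorem act_mem_cone_of_mem_unitaryGroup {g : GL (Fin (p + 1)) D.E}
    (hg : g ∈ unitaryGroup (conjRingHom D.E) D.H) {v : Fin (p + 1) → ℂ} (hv : v ∈ D.cone) :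
    D.act g v ∈ D.cone := by
  have hu := D.conjTranspose_mul_Hℂ_mul hg
  change (star ((((g : Matrix (Fin (p + 1)) (Fin (p + 1)) D.E)).map D.τ₁) *ᵥ v) ⬝ᵥ
    (D.Hℂ *ᵥ ((((g : Matrix (Fin (p + 1)) (Fin (p + 1)) D.E)).map D.τ₁) *ᵥ v))).re < 0
  rw [star_mulVec, mulVec_mulVec, dotProduct_mulVec, vecMul_vecMul, ← Matrix.mul_assoc, hu,
    ← dotProduct_mulVec]
  exact hv

/-- `v ↦ g v` is continuous. [folklore] -/
theorem continuous_act (g : GL (Fin (p + 1)) D.E) : Continuous (D.act g) :=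
  continuous_const.matrix_mulVec continuous_id

/-- `unif (γ v) = unif v` for `γ ∈ Γ`: the uniformization is `Γ`-invariant.
[cite: BergeronMillsonMoeglin2016Balls, Introduction §1.1] -/
theorem unif_act {γ : GL (Fin (p + 1)) D.E} (hγ : γ ∈ D.Γ) {v : Fin (p + 1) → ℂ} (hv : v ∈ D.cone) :
    D.unif (D.act γ v) = D.unif v :=
  ((D.unif_eq_unif_iff v hv (D.act γ v) (D.act_mem_cone hγ hv)).2
    ⟨γ, hγ, 1, one_ne_zero, (one_smul ℂ _).symm⟩).symm

/-! #### The ball `𝔹` of negative lines and the action of `Γ` -/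

/-- Non-zero scalars act on the negative cone. [cite: BergeronMillsonMoeglin2016Balls, Part 2 §1.3] -/
instance unitsMulActionCone : MulAction ℂˣ D.cone where
  smul c v := ⟨(c : ℂ) • (v : Fin (p + 1) → ℂ), smul_mem_negCone c.ne_zero v.2⟩
  one_smul v := Subtype.ext (by change ((1 : ℂˣ) : ℂ) • (v : Fin (p + 1) → ℂ) = v; simp)
  mul_smul a b v := Subtype.ext (by
    change ((a * b : ℂˣ) : ℂ) • (v : Fin (p + 1) → ℂ) = (a : ℂ) • (b : ℂ) • (v : Fin (p + 1) → ℂ)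
    rw [Units.val_mul, mul_smul])

/-- Unfolding the scalar action on the cone. [folklore] -/
@[simp]
theorem coe_units_smul (c : ℂˣ) (v : D.cone) :
    ((c • v : D.cone) : Fin (p + 1) → ℂ) = (c : ℂ) • (v : Fin (p + 1) → ℂ) := rfl

/-- `Γ` acts on the negative cone through `τ₁`. [cite: BergeronMillsonMoeglin2016Balls, Part 2 §1.3] -/
instance subgroupMulActionCone : MulAction ↥D.Γ D.cone where
  smul γ v := ⟨D.act γ v, D.act_mem_cone γ.2 v.2⟩
  one_smul v := Subtype.ext (D.act_one v)
  mul_smul a b v := Subtype.ext (D.act_mul a b v)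

/-- Unfolding the action of `Γ` on the cone. [folklore] -/
@[simp]
theorem coe_subgroup_smul (γ : ↥D.Γ) (v : D.cone) :
    ((γ • v : D.cone) : Fin (p + 1) → ℂ) = D.act γ v := rfl

/-- The actions of `Γ` and of the scalars on the cone commute (the action is linear). [folklore] -/
instance smulCommClass_cone : SMulCommClass ↥D.Γ ℂˣ D.cone where
  smul_comm γ c v := Subtype.ext (by
    change D.act γ ((c : ℂ) • (v : Fin (p + 1) → ℂ)) = (c : ℂ) • D.act γ v
    exact D.act_smul _ _ _)

/-- `Γ` acts on the cone by homeomorphisms. [folklore] -/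
instance continuousConstSMul_cone : ContinuousConstSMul ↥D.Γ D.cone where
  continuous_const_smul γ :=
    ((D.continuous_act γ).comp continuous_subtype_val).subtype_mk _

/-- The **ball** `𝔹 = 𝔹(V_{τ₁})` of negative lines: the negative cone modulo non-zero scalars
(BMM Part 2 §1.3: the symmetric space of `U(p,1)` "is the space of negative lines"), with the
quotient topology. [cite: BergeronMillsonMoeglin2016Balls, Part 2 §1.3] -/
abbrev ball : Type := orbitRel.Quotient ℂˣ D.cone

/-- The negative line through a vector of the cone. [cite: BergeronMillsonMoeglin2016Balls, Part 2 §1.3] -/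
abbrev toBall (v : D.cone) : D.ball := Quotient.mk (orbitRel ℂˣ D.cone) v

/-- Two cone vectors span the same negative line iff they are proportional. [folklore] -/
theorem toBall_eq_toBall_iff (v w : D.cone) : D.toBall v = D.toBall w ↔ ∃ c : ℂˣ, c • w = v :=
  Quotient.eq.trans MulAction.orbitRel_apply

/-- `toBall` is onto. [folklore] -/
theorem toBall_surjective : Function.Surjective D.toBall := Quotient.mk_surjective

/-- **The action of `Γ` on the ball** `𝔹`, `γ · [v] = [γ v]`. [cite: BergeronMillsonMoeglin2016Balls, Introduction §1.1] -/
instance subgroupMulActionBall : MulAction ↥D.Γ D.ball where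
  smul γ := Quotient.map' (γ • ·) fun v w h => by
    obtain ⟨c, rfl⟩ := MulAction.orbitRel_apply.1 h
    exact MulAction.orbitRel_apply.2 ⟨c, (smul_comm γ c w).symm⟩
  one_smul b := Quotient.inductionOn' b fun v =>
    congrArg (Quotient.mk (orbitRel ℂˣ D.cone)) (one_smul (↥D.Γ) v)
  mul_smul a a' b := Quotient.inductionOn' b fun v =>
    congrArg (Quotient.mk (orbitRel ℂˣ D.cone)) (mul_smul a a' v)

/-- `γ · [v] = [γ v]`. [folklore] -/
@[simp]
theorem smul_toBall (γ : ↥D.Γ) (v : D.cone) : γ • D.toBall v = D.toBall (γ • v) := rfl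

/-- `Γ` acts on the ball by homeomorphisms. [folklore] -/
instance continuousConstSMul_ball : ContinuousConstSMul ↥D.Γ D.ball where
  continuous_const_smul γ := (continuous_const_smul γ).quotient_map' _

/-- The uniformization `𝔹 → X(ℂ)` induced by `unif` (`unif` is constant on punctured lines,
`unif_smul`). [cite: BergeronMillsonMoeglin2016Balls, Introduction §1.1] -/
def ballUnif : D.ball → ComplexPoints X :=
  Quotient.lift (fun v : D.cone => D.unif v) fun v w h => by
    obtain ⟨c, rfl⟩ := MulAction.orbitRel_apply.1 h
    exact D.unif_smul c.ne_zero w.2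

/-- `ballUnif [v] = unif v`. [folklore] -/
@[simp]
theorem ballUnif_toBall (v : D.cone) : D.ballUnif (D.toBall v) = D.unif v := rfl

/-- `ballUnif` is continuous. [cite: BergeronMillsonMoeglin2016Balls, Introduction §1.1] -/
theorem continuous_ballUnif : Continuous D.ballUnif :=
  continuous_quot_lift _ D.continuousOn_unif.restrict

/-- `ballUnif` is onto `X(ℂ)`. [cite: BergeronMillsonMoeglin2016Balls, Introduction §1.1] -/
theorem surjective_ballUnif : Function.Surjective D.ballUnif := fun P => by
  obtain ⟨v, hv, rfl⟩ := D.surjOn_unif (Set.mem_univ P)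
  exact ⟨D.toBall ⟨v, hv⟩, rfl⟩

/-- `ballUnif` is `Γ`-invariant. [cite: BergeronMillsonMoeglin2016Balls, Introduction §1.1] -/
@[simp]
theorem ballUnif_smul (γ : ↥D.Γ) (b : D.ball) : D.ballUnif (γ • b) = D.ballUnif b := by
  induction b using Quotient.inductionOn with
  | h v => exact D.unif_act γ.2 v.2

/-- **The fibres of `𝔹 → X(ℂ)` are the `Γ`-orbits** (field `unif_eq_unif_iff`).
[cite: BergeronMillsonMoeglin2016Balls, Introduction §1.1] -/
theorem ballUnif_eq_iff (b b' : D.ball) : D.ballUnif b = D.ballUnif b' ↔ b ∈ orbit ↥D.Γ b' := by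
  induction b using Quotient.inductionOn with
  | h v =>
  induction b' using Quotient.inductionOn with
  | h w =>
  change D.unif v = D.unif w ↔ _
  rw [eq_comm, D.unif_eq_unif_iff w w.2 v v.2, MulAction.mem_orbit_iff]
  constructor
  · rintro ⟨γ, hγ, c, hc, h⟩
    refine ⟨⟨γ, hγ⟩, ?_⟩
    change D.toBall ((⟨γ, hγ⟩ : ↥D.Γ) • w) = D.toBall v
    exact (D.toBall_eq_toBall_iff _ _).2 ⟨Units.mk0 c hc, Subtype.ext h.symm⟩
  · rintro ⟨γ, h⟩
    change D.toBall (γ • w) = D.toBall v at h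
    obtain ⟨c, hc⟩ := (D.toBall_eq_toBall_iff _ _).1 h
    exact ⟨γ, γ.2, c, c.ne_zero, congrArg Subtype.val hc.symm⟩

/-- `ballUnif` is an open map (`unif` is open on the cone).
[cite: BergeronMillsonMoeglin2016Balls, Introduction §1.1] -/
theorem isOpenMap_ballUnif : IsOpenMap D.ballUnif := fun O hO => by
  have : D.ballUnif '' O = D.cone.restrict D.unif '' (D.toBall ⁻¹' O) := by
    ext P
    constructor
    · rintro ⟨b, hb, rfl⟩
      induction b using Quotient.inductionOn with
      | h v => exact ⟨v, hb, rfl⟩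
    · rintro ⟨v, hv, rfl⟩
      exact ⟨D.toBall v, hv, rfl⟩
  rw [this]
  exact D.isOpenMap_unif _ (hO.preimage continuous_quotient_mk')

/-- **`𝔹 → X(ℂ)` is an open quotient map** (so `X(ℂ) = Γ \ 𝔹` as a topological space).
[cite: BergeronMillsonMoeglin2016Balls, Introduction §1.1] -/
theorem isOpenQuotientMap_ballUnif : IsOpenQuotientMap D.ballUnif :=
  ⟨D.surjective_ballUnif, D.continuous_ballUnif, D.isOpenMap_ballUnif⟩

/-! #### Level covers `N \ 𝔹 → X(ℂ)` and their deck groups `Γ / N` -/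

section Level

variable (N : Subgroup ↥D.Γ)

/-- The **level-`N` cover** `N \ 𝔹` of `X(ℂ) = Γ \ 𝔹`, for a subgroup `N ≤ Γ`: the orbit space of
`N` on the ball, with the quotient topology (for `N` of finite index a compact quotient `S(N)`
finite étale over `S(Γ)`). [cite: Shimura1973, §7.2] -/
abbrev LevelCover : Type := orbitRel.Quotient ↥N D.ball

/-- The point of `N \ 𝔹` under a point of the ball. [folklore] -/
abbrev toLevel (b : D.ball) : D.LevelCover N := Quotient.mk (orbitRel ↥N D.ball) b

/-- The **covering projection** `N \ 𝔹 → Γ \ 𝔹 = X(ℂ)`, `N b ↦ Γ b`. [cite: Shimura1973, §7.2] -/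
def levelProj : C(D.LevelCover N, ComplexPoints X) where
  toFun := Quotient.lift D.ballUnif fun b b' h => by
    obtain ⟨n, rfl⟩ := MulAction.orbitRel_apply.1 h
    exact D.ballUnif_smul n b'
  continuous_toFun := continuous_quot_lift _ D.continuous_ballUnif

/-- `levelProj (N b) = ballUnif b`. [folklore] -/
@[simp]
theorem levelProj_toLevel (b : D.ball) : D.levelProj N (D.toLevel N b) = D.ballUnif b := rfl

/-- `levelProj` is onto. [folklore] -/
theorem surjective_levelProj : Function.Surjective (D.levelProj N) := fun P => by
  obtain ⟨b, rfl⟩ := D.surjective_ballUnif P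
  exact ⟨D.toLevel N b, rfl⟩

variable {N} in
/-- The **translated projection** `N \ 𝔹 → X(ℂ)`, `N [v] ↦ Γ [g v]`, for `g ∈ U(V)(F)` with
`g N g⁻¹ ⊆ Γ` (for `g = 1` the covering projection; for `N ≤ Γ ∩ g⁻¹Γg` the second projection
`π_g` of the Hecke correspondence of `g`). [cite: Shimura1973, §7.3] -/
def coverMap (g : GL (Fin (p + 1)) D.E) (hg : g ∈ unitaryGroup (conjRingHom D.E) D.H)
    (hN : ∀ γ ∈ N, g * (γ : GL (Fin (p + 1)) D.E) * g⁻¹ ∈ D.Γ) :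
    C(D.LevelCover N, ComplexPoints X) where
  toFun := Quotient.lift
    (Quotient.lift (fun v : D.cone => D.unif (D.act g v)) fun v w h => by
      obtain ⟨c, rfl⟩ := MulAction.orbitRel_apply.1 h
      change D.unif (D.act g ((c : ℂ) • (w : Fin (p + 1) → ℂ))) = D.unif (D.act g w)
      rw [D.act_smul]
      exact D.unif_smul c.ne_zero (D.act_mem_cone_of_mem_unitaryGroup hg w.2))
    fun b b' h => by
      obtain ⟨n, rfl⟩ := MulAction.orbitRel_apply.1 h
      induction b' using Quotient.inductionOn with
      | h w =>
        change D.unif (D.act g (D.act (n : ↥D.Γ) w)) = D.unif (D.act g w)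
        have hgw : D.act g w ∈ D.cone := D.act_mem_cone_of_mem_unitaryGroup hg w.2
        rw [← D.act_mul, ← inv_mul_cancel_right (g * _) g, D.act_mul _ g]
        exact D.unif_act (hN n n.2) hgw
  continuous_toFun := continuous_quot_lift _ (continuous_quot_lift _
    (D.continuousOn_unif.comp_continuous ((D.continuous_act g).comp continuous_subtype_val)
      fun v => D.act_mem_cone_of_mem_unitaryGroup hg v.2))

variable {N} in
/-- `coverMap g (N [v]) = unif (g v)`. [folklore] -/
@[simp]
theorem coverMap_toLevel_toBall (g : GL (Fin (p + 1)) D.E)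
    (hg : g ∈ unitaryGroup (conjRingHom D.E) D.H)
    (hN : ∀ γ ∈ N, g * (γ : GL (Fin (p + 1)) D.E) * g⁻¹ ∈ D.Γ) (v : D.cone) :
    D.coverMap g hg hN (D.toLevel N (D.toBall v)) = D.unif (D.act g v) := rfl

variable {N} in
/-- For `γ ∈ Γ` the translated projection is the covering projection: `Γ [γ v] = Γ [v]`.
[cite: Shimura1973, §7.2] -/
theorem coverMap_of_mem {γ : GL (Fin (p + 1)) D.E} (hγ : γ ∈ D.Γ)
    (hg : γ ∈ unitaryGroup (conjRingHom D.E) D.H)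
    (hN : ∀ δ ∈ N, γ * (δ : GL (Fin (p + 1)) D.E) * γ⁻¹ ∈ D.Γ) :
    D.coverMap γ hg hN = D.levelProj N := by
  refine ContinuousMap.ext fun e => ?_
  induction e using Quotient.inductionOn with
  | h b =>
  induction b using Quotient.inductionOn with
  | h v => exact D.unif_act hγ v.2

variable [N.Normal]

/-- The deck action of `Γ / N` on `N \ 𝔹` (`(γN) · N b = N γ b`, file `OrbitQuotientCovering`)
covers the projection: `levelProj (q · e) = levelProj e`. [cite: Shimura1973, §7.2] -/
theorem levelProj_smul (q : ↥D.Γ ⧸ N) (e : D.LevelCover N) : D.levelProj N (q • e) = D.levelProj N e := by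
  induction q using QuotientGroup.induction_on with
  | H γ =>
  induction e using Quotient.inductionOn with
  | h b =>
    change D.levelProj N ((QuotientGroup.mk γ : ↥D.Γ ⧸ N) • Quotient.mk (orbitRel ↥N D.ball) b) = _
    rw [OrbitQuotient.mk_smul_mk]
    exact D.ballUnif_smul γ b

/-- **`Γ / N` is transitive on the fibres of `N \ 𝔹 → X(ℂ)`** (the fibres of `𝔹 → X(ℂ)` are the
`Γ`-orbits). [cite: Shimura1973, §7.2] -/
theorem exists_smul_of_levelProj_eq {e e' : D.LevelCover N} (h : D.levelProj N e' = D.levelProj N e) :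
    ∃ q : ↥D.Γ ⧸ N, e' = q • e := by
  induction e using Quotient.inductionOn with
  | h b =>
  induction e' using Quotient.inductionOn with
  | h b' =>
    change D.ballUnif b' = D.ballUnif b at h
    obtain ⟨q, hq⟩ := MulAction.mem_orbit_iff.1
      ((OrbitQuotient.mk_mem_orbit_mk_iff N).2 ((D.ballUnif_eq_iff b' b).1 h))
    exact ⟨q, hq.symm⟩

/-- The translated projection composed with a deck transformation: `π_g ∘ (γN) = (N[v] ↦ Γ[g γ v])`,
the translated projection of `g γ` (the summands `gⱼ = g γⱼ` of `T_{ΓgΓ} = Σⱼ gⱼ^*`).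
[cite: Shimura1973, §3.1] -/
theorem coverMap_comp_smul (g : GL (Fin (p + 1)) D.E) (hg : g ∈ unitaryGroup (conjRingHom D.E) D.H)
    (hN : ∀ γ ∈ N, g * (γ : GL (Fin (p + 1)) D.E) * g⁻¹ ∈ D.Γ) (γ : ↥D.Γ) :
    (D.coverMap g hg hN).comp ⟨fun e : D.LevelCover N => (QuotientGroup.mk γ : ↥D.Γ ⧸ N) • e,
        continuous_const_smul _⟩ =
      D.coverMap (g * γ) (mul_mem hg (D.isCongruenceSubgroup.1 γ.2)) (fun δ hδ => by
        have h := hN (γ * δ * γ⁻¹) (Subgroup.Normal.conj_mem inferInstance δ hδ γ)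
        simpa only [Subgroup.coe_mul, InvMemClass.coe_inv, mul_assoc, _root_.mul_inv_rev] using h) := by
  refine ContinuousMap.ext fun e => ?_
  induction e using Quotient.inductionOn with
  | h b =>
  induction b using Quotient.inductionOn with
  | h v =>
    change D.coverMap g hg hN ((QuotientGroup.mk γ : ↥D.Γ ⧸ N) •
      Quotient.mk (orbitRel ↥N D.ball) (D.toBall v)) = D.unif (D.act (g * γ) v)
    rw [OrbitQuotient.mk_smul_mk, D.act_mul]
    rfl

/-- **The level-`N` cover as a finite regular covering of `X(ℂ)`** with deck group `Γ / N`
(`N ⊴ Γ` of finite index), given that the projection `N \ 𝔹 → X(ℂ)` is a covering map — which holds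
for every such `N` since `Γ` acts freely and properly discontinuously on `𝔹` (not proved in this
file; see `IsHeckeAdmissible`). [cite: Shimura1973, §7.2] [cite: HatcherAT2002, §1.3 Prop. 1.39] -/
def levelDeckCover [Fintype (↥D.Γ ⧸ N)] (hcov : IsCoveringMap (D.levelProj N)) :
    FiniteDeckCover (↥D.Γ ⧸ N) (D.LevelCover N) (ComplexPoints X) where
  proj := D.levelProj N
  isCoveringMap_proj := hcov
  surjective_proj := D.surjective_levelProj N
  continuous_smul q := continuous_const_smul q
  proj_smul q e := D.levelProj_smul N q e
  exists_smul_of_proj_eq h := D.exists_smul_of_levelProj_eq N h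

/-- The projection of `levelDeckCover` is `levelProj`. [folklore] -/
@[simp]
theorem levelDeckCover_proj [Fintype (↥D.Γ ⧸ N)] (hcov : IsCoveringMap (D.levelProj N)) :
    (D.levelDeckCover N hcov).proj = D.levelProj N := rfl

/-- The deck transformations of `levelDeckCover` are the action of `Γ / N`. [folklore] -/
@[simp]
theorem levelDeckCover_deck_apply [Fintype (↥D.Γ ⧸ N)] (hcov : IsCoveringMap (D.levelProj N))
    (q : ↥D.Γ ⧸ N) (e : D.LevelCover N) : (D.levelDeckCover N hcov).deck q e = q • e := rfl

omit [N.Normal] in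
/-- If `N = Γ` (every element of `Γ` lies in `N`) the projection `N \ 𝔹 → X(ℂ)` is a homeomorphism
(`X(ℂ) = Γ \ 𝔹`), in particular a covering map. [cite: BergeronMillsonMoeglin2016Balls, Introduction §1.1] -/
theorem isCoveringMap_levelProj_of_forall_mem (hN : ∀ γ : ↥D.Γ, γ ∈ N) :
    IsCoveringMap (D.levelProj N) := by
  have hinj : Function.Injective (D.levelProj N) := by
    intro e e' h
    induction e using Quotient.inductionOn with
    | h b =>
    induction e' using Quotient.inductionOn with
    | h b' =>
      change D.ballUnif b = D.ballUnif b' at h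
      obtain ⟨γ, rfl⟩ := MulAction.mem_orbit_iff.1 ((D.ballUnif_eq_iff b b').1 h)
      exact Quotient.sound (MulAction.orbitRel_apply.2 (MulAction.mem_orbit_iff.2 ⟨⟨γ, hN γ⟩, rfl⟩))
  have hopen : IsOpenMap (D.levelProj N) := fun O hO => by
    have : D.levelProj N '' O = D.ballUnif '' (D.toLevel N ⁻¹' O) := by
      ext P
      constructor
      · rintro ⟨e, he, rfl⟩
        induction e using Quotient.inductionOn with
        | h b => exact ⟨b, he, rfl⟩
      · rintro ⟨b, hb, rfl⟩
        exact ⟨D.toLevel N b, hb, rfl⟩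
    rw [this]
    exact D.isOpenMap_ballUnif _ (hO.preimage continuous_quotient_mk')
  exact isCoveringMap_homeomorph
    ((Equiv.ofBijective _ ⟨hinj, D.surjective_levelProj N⟩).toHomeomorphOfContinuousOpen
      (D.levelProj N).continuous hopen)

end Level

/-! #### The Hecke operators -/

section Hecke

variable (g : GL (Fin (p + 1)) D.E)

/-- The subgroup `Γ ∩ g⁻¹ Γ g` of `Γ` (the `γ ∈ Γ` with `g γ g⁻¹ ∈ Γ`): the level of the Hecke
correspondence of `g`; `Γ g Γ = ⊔ Γ g γⱼ` over coset representatives `Γ = ⊔ (Γ ∩ g⁻¹Γg) γⱼ`.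
[cite: Shimura1973, §3.1] -/
def heckeStabilizer : Subgroup ↥D.Γ where
  carrier := {γ | g * (γ : GL (Fin (p + 1)) D.E) * g⁻¹ ∈ D.Γ}
  one_mem' := by simp
  mul_mem' {a b} ha hb := by
    have h : g * ((a * b : ↥D.Γ) : GL (Fin (p + 1)) D.E) * g⁻¹ =
        (g * (a : GL (Fin (p + 1)) D.E) * g⁻¹) * (g * (b : GL (Fin (p + 1)) D.E) * g⁻¹) := by
      simp only [Subgroup.coe_mul]; group
    rw [Set.mem_setOf_eq, h]
    exact mul_mem ha hb
  inv_mem' {a} ha := by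
    have h : g * ((a⁻¹ : ↥D.Γ) : GL (Fin (p + 1)) D.E) * g⁻¹ =
        (g * (a : GL (Fin (p + 1)) D.E) * g⁻¹)⁻¹ := by
      simp only [InvMemClass.coe_inv]; group
    rw [Set.mem_setOf_eq, h]
    exact inv_mem ha

/-- Membership in `Γ ∩ g⁻¹Γg`. [cite: Shimura1973, §3.1] -/
theorem mem_heckeStabilizer_iff (γ : ↥D.Γ) :
    γ ∈ D.heckeStabilizer g ↔ g * (γ : GL (Fin (p + 1)) D.E) * g⁻¹ ∈ D.Γ :=
  Iff.rfl

/-- The **Hecke level** `N_g`: the normal core in `Γ` of `Γ ∩ g⁻¹Γg`, the largest normal subgroup of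
`Γ` on whose (regular) cover `N_g \ 𝔹 → Γ \ 𝔹` the Hecke correspondence of `g` is defined.
[cite: Shimura1973, §3.1] -/
def heckeLevel : Subgroup ↥D.Γ := (D.heckeStabilizer g).normalCore

/-- `N_g` is normal in `Γ`. [folklore] -/
instance heckeLevel_normal : (D.heckeLevel g).Normal :=
  Subgroup.normalCore_normal _

/-- `N_g ≤ Γ ∩ g⁻¹Γg`. [folklore] -/
theorem heckeLevel_le : D.heckeLevel g ≤ D.heckeStabilizer g :=
  Subgroup.normalCore_le _

/-- `g N_g g⁻¹ ⊆ Γ`. [cite: Shimura1973, §3.1] -/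
theorem conj_mem_of_mem_heckeLevel {γ : ↥D.Γ} (h : γ ∈ D.heckeLevel g) :
    g * (γ : GL (Fin (p + 1)) D.E) * g⁻¹ ∈ D.Γ :=
  D.heckeLevel_le g h

/-- The normalising index `[Γ ∩ g⁻¹Γg : N_g]` (the multiplicity with which each coset `Γ g γⱼ` of
`Γ g Γ` occurs among the `Γ g γ`, `γ ∈ N_g \ Γ`). [cite: Shimura1973, §3.1] -/
def heckeIndex : ℕ := (D.heckeLevel g).relIndex (D.heckeStabilizer g)

/-- **Admissibility of `g` for the Hecke correspondence** (holds for every `g ∈ U(V)(F)`; proved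
below for `g ∈ Γ`): `g` is an isometry of `V`, the Hecke level `N_g` has finite index in `Γ`
(`U(V)(F)` commensurates `Γ`, Shimura 1971 §3.1/§3.3), and `N_g \ 𝔹 → X(ℂ)` is a covering map (`Γ`
acts freely and properly discontinuously on `𝔹`). [cite: Shimura1973, §3.1 and §7.2] -/
structure IsHeckeAdmissible : Prop where
  /-- `g ∈ U(V)(F)`. -/
  mem_unitaryGroup : g ∈ unitaryGroup (conjRingHom D.E) D.H
  /-- `[Γ : N_g] < ∞`. -/
  finiteIndex : (D.heckeLevel g).FiniteIndex
  /-- `N_g \ 𝔹 → X(ℂ)` is a covering map. -/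
  isCoveringMap : IsCoveringMap (D.levelProj (D.heckeLevel g))

variable {g} in
/-- The finite regular cover `N_g \ 𝔹 → X(ℂ)` carrying the Hecke correspondence of an admissible `g`.
[cite: Shimura1973, §7.2] -/
def IsHeckeAdmissible.deckCover (h : D.IsHeckeAdmissible g) :
    letI : (D.heckeLevel g).FiniteIndex := h.finiteIndex
    letI : Fintype (↥D.Γ ⧸ D.heckeLevel g) := Subgroup.fintypeQuotientOfFiniteIndex
    FiniteDeckCover (↥D.Γ ⧸ D.heckeLevel g) (D.LevelCover (D.heckeLevel g)) (ComplexPoints X) :=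
  letI : (D.heckeLevel g).FiniteIndex := h.finiteIndex
  letI : Fintype (↥D.Γ ⧸ D.heckeLevel g) := Subgroup.fintypeQuotientOfFiniteIndex
  D.levelDeckCover (D.heckeLevel g) h.isCoveringMap

variable {g} in
/-- The second projection `π_g : N_g \ 𝔹 → X(ℂ)`, `N_g[v] ↦ Γ[g v]`, of the Hecke correspondence of
an admissible `g`. [cite: Shimura1973, §7.3] -/
def IsHeckeAdmissible.twist (h : D.IsHeckeAdmissible g) :
    C(D.LevelCover (D.heckeLevel g), ComplexPoints X) :=
  D.coverMap g h.mem_unitaryGroup fun _ hγ => D.conj_mem_of_mem_heckeLevel g hγ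

open scoped Classical in
/-- **The Hecke operator `T_g = T_{ΓgΓ}` on `Hᵏ(X(ℂ); ℂ)`** of `g ∈ U(V)(F)` for the compact ball
quotient `X(ℂ) ≅ Γ \ 𝔹`: transfer composed with pull-back, `T_g = [Γ ∩ g⁻¹Γg : N_g]⁻¹ · τ ∘ π_g^*`,
through the finite regular cover `N_g \ 𝔹 → X(ℂ)` and its second projection `π_g[v] = [g v]` — the
classical `(T_g f)(v) = Σⱼ f(gⱼ v)`, `Γ g Γ = ⊔ⱼ Γ gⱼ` (Shimura 1971, §3.4 (3.4.1), §8.3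
(8.3.2)), i.e. the action `π_* π_g^*` of the Hecke correspondence, an algebraic
correspondence on `X × X` (Shimura 1971 Ch. 7; BMM Part 2 §1.8, Thm. 61). Junk value `0` when `g` is
not admissible (`IsHeckeAdmissible`; every `g ∈ U(V)(F)` is).
[cite: Shimura1973, §3.4 and §8.3] [cite: BergeronMillsonMoeglin2016Balls, Part 2 §1.8] -/
def heckeCorrespondenceAction (k : ℕ) (g : GL (Fin (p + 1)) D.E) : Module.End ℂ (complexBetti X k) :=
  if h : D.IsHeckeAdmissible g then
    letI : (D.heckeLevel g).FiniteIndex := h.finiteIndex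
    letI : Fintype (↥D.Γ ⧸ D.heckeLevel g) := Subgroup.fintypeQuotientOfFiniteIndex
    ((D.heckeIndex g : ℂ)⁻¹) •
      ((h.deckCover.transferMap (R := ℂ) k).hom ∘ₗ (singularCohomology.map ℂ ℂ h.twist k).hom)
  else 0

/-! #### API: unfolding, `T_γ = 1` for `γ ∈ Γ`, the defining identity, rationality -/

variable {g}

/-- Junk case: `T_g = 0` for non-admissible `g`. [folklore] -/
theorem heckeCorrespondenceAction_of_not (h : ¬ D.IsHeckeAdmissible g) (k : ℕ) :
    D.heckeCorrespondenceAction k g = 0 :=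
  dif_neg h

/-- Unfolding `T_g = [Γ ∩ g⁻¹Γg : N_g]⁻¹ · τ ∘ π_g^*` for admissible `g`. [cite: Shimura1973, §8.3] -/
theorem heckeCorrespondenceAction_eq (h : D.IsHeckeAdmissible g) (k : ℕ) :
    D.heckeCorrespondenceAction k g =
      letI : (D.heckeLevel g).FiniteIndex := h.finiteIndex
      letI : Fintype (↥D.Γ ⧸ D.heckeLevel g) := Subgroup.fintypeQuotientOfFiniteIndex
      ((D.heckeIndex g : ℂ)⁻¹) •
        ((h.deckCover.transferMap (R := ℂ) k).hom ∘ₗ (singularCohomology.map ℂ ℂ h.twist k).hom) :=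
  dif_pos h

/-- `T_g x = [Γ ∩ g⁻¹Γg : N_g]⁻¹ · τ (π_g^* x)` for admissible `g`. [cite: Shimura1973, §8.3] -/
theorem heckeCorrespondenceAction_apply (h : D.IsHeckeAdmissible g) (k : ℕ) (x : complexBetti X k) :
    D.heckeCorrespondenceAction k g x =
      letI : (D.heckeLevel g).FiniteIndex := h.finiteIndex
      letI : Fintype (↥D.Γ ⧸ D.heckeLevel g) := Subgroup.fintypeQuotientOfFiniteIndex
      ((D.heckeIndex g : ℂ)⁻¹) • h.deckCover.transferMap k (singularCohomology.map ℂ ℂ h.twist k x) := by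
  rw [D.heckeCorrespondenceAction_eq h k]
  rfl

/-- For `γ ∈ Γ`: `Γ ∩ γ⁻¹Γγ = Γ`. [cite: Shimura1973, §3.1] -/
theorem heckeStabilizer_eq_top_of_mem {γ : GL (Fin (p + 1)) D.E} (hγ : γ ∈ D.Γ) :
    D.heckeStabilizer γ = ⊤ :=
  eq_top_iff.2 fun δ _ => mul_mem (mul_mem hγ δ.2) (inv_mem hγ)

/-- For `γ ∈ Γ`: `N_γ = Γ`. [cite: Shimura1973, §3.1] -/
theorem heckeLevel_eq_top_of_mem {γ : GL (Fin (p + 1)) D.E} (hγ : γ ∈ D.Γ) : D.heckeLevel γ = ⊤ :=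
  eq_top_iff.2 ((Subgroup.normal_le_normalCore (N := ⊤)).2
    (eq_top_iff.1 (D.heckeStabilizer_eq_top_of_mem hγ)))

/-- For `γ ∈ Γ`: `[Γ ∩ γ⁻¹Γγ : N_γ] = 1`. [cite: Shimura1973, §3.1] -/
theorem heckeIndex_of_mem {γ : GL (Fin (p + 1)) D.E} (hγ : γ ∈ D.Γ) : D.heckeIndex γ = 1 :=
  Subgroup.relIndex_eq_one.2 (by rw [D.heckeLevel_eq_top_of_mem hγ]; exact le_top)

/-- **Elements of `Γ` are admissible**: for `γ ∈ Γ` the level is `N_γ = Γ`, of index `1`, and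
`Γ \ 𝔹 → X(ℂ)` is a homeomorphism, hence a covering map — the whole construction runs.
[cite: BergeronMillsonMoeglin2016Balls, Introduction §1.1] -/
theorem isHeckeAdmissible_of_mem {γ : GL (Fin (p + 1)) D.E} (hγ : γ ∈ D.Γ) : D.IsHeckeAdmissible γ where
  mem_unitaryGroup := D.isCongruenceSubgroup.1 hγ
  finiteIndex := by
    rw [D.heckeLevel_eq_top_of_mem hγ]
    infer_instance
  isCoveringMap := D.isCoveringMap_levelProj_of_forall_mem _ fun δ => by
    rw [D.heckeLevel_eq_top_of_mem hγ]
    exact Subgroup.mem_top δ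

/-- **`T_γ = 1` for `γ ∈ Γ`** (`Γ γ Γ = Γ`): here `π_γ = π` is a homeomorphism, `τ ∘ π^* = |Γ/N_γ| = 1`
and the normalising index is `1`. In particular `T_1 = 1`. [cite: Shimura1973, §3.1] -/
theorem heckeCorrespondenceAction_of_mem {γ : GL (Fin (p + 1)) D.E} (hγ : γ ∈ D.Γ) (k : ℕ) :
    D.heckeCorrespondenceAction k γ = 1 := by
  have h := D.isHeckeAdmissible_of_mem hγ
  haveI : (D.heckeLevel γ).FiniteIndex := h.finiteIndex
  letI : Fintype (↥D.Γ ⧸ D.heckeLevel γ) := Subgroup.fintypeQuotientOfFiniteIndex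
  refine LinearMap.ext fun x => ?_
  rw [D.heckeCorrespondenceAction_apply h k x]
  have htw : h.twist = h.deckCover.proj :=
    D.coverMap_of_mem hγ h.mem_unitaryGroup fun _ hδ => D.conj_mem_of_mem_heckeLevel γ hδ
  dsimp only
  rw [htw, FiniteDeckCover.transferMap_map, D.heckeIndex_of_mem hγ, Fintype.card_eq_nat_card,
    ← Subgroup.index_eq_card, Subgroup.index_eq_one.2 (D.heckeLevel_eq_top_of_mem hγ)]
  simp

/-- `T_1 = 1`. [cite: Shimura1973, §3.1] -/
theorem heckeCorrespondenceAction_one (k : ℕ) : D.heckeCorrespondenceAction k 1 = 1 :=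
  D.heckeCorrespondenceAction_of_mem (one_mem _) k

/-- **The defining identity of `T_g` on the level-`N_g` cover**: pulled back along
`π : N_g \ 𝔹 → X(ℂ)`, `π^*(T_g x) = [Γ ∩ g⁻¹Γg : N_g]⁻¹ · Σ_{q ∈ Γ/N_g} (π_g ∘ q)^* x`, where
`π_g ∘ (γ N_g) : N_g[v] ↦ Γ[g γ v]` (`coverMap_comp_smul`) — the classical `(T_g f)(v) = Σⱼ f(gⱼ v)`
over `Γ g Γ = ⊔ⱼ Γ gⱼ`, each coset `Γ g γ` being counted `[Γ ∩ g⁻¹Γg : N_g]` times as `γ` ranges over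
`Γ / N_g`. [cite: Shimura1973, §3.4 and §8.3] -/
theorem levelProj_map_heckeCorrespondenceAction (h : D.IsHeckeAdmissible g) (k : ℕ)
    (x : complexBetti X k) :
    letI : (D.heckeLevel g).FiniteIndex := h.finiteIndex
    letI : Fintype (↥D.Γ ⧸ D.heckeLevel g) := Subgroup.fintypeQuotientOfFiniteIndex
    singularCohomology.map ℂ ℂ (D.levelProj (D.heckeLevel g)) k (D.heckeCorrespondenceAction k g x) =
      ((D.heckeIndex g : ℂ)⁻¹) • ∑ q : ↥D.Γ ⧸ D.heckeLevel g,
        singularCohomology.map ℂ ℂ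
          (h.twist.comp ⟨fun e : D.LevelCover (D.heckeLevel g) => q • e, continuous_const_smul q⟩) k x := by
  haveI : (D.heckeLevel g).FiniteIndex := h.finiteIndex
  letI : Fintype (↥D.Γ ⧸ D.heckeLevel g) := Subgroup.fintypeQuotientOfFiniteIndex
  rw [D.heckeCorrespondenceAction_apply h k x]
  dsimp only
  rw [map_smul]
  congr 1
  rw [show D.levelProj (D.heckeLevel g) = h.deckCover.proj from rfl,
    FiniteDeckCover.map_proj_transferMap]
  refine Finset.sum_congr rfl fun q _ => ?_
  change (singularCohomology.map ℂ ℂ h.twist k ≫ singularCohomology.map ℂ ℂ (h.deckCover.deck q) k) x = _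
  rw [← singularCohomology.map_comp]
  rfl

/-- The summands of the defining identity: `π_g ∘ (γ N_g) = (N_g[v] ↦ Γ[g γ v])`, the translated
projection of the representative `g γ` of a coset of `Γ g Γ`. [cite: Shimura1973, §3.1 Prop. 3.1] -/
theorem IsHeckeAdmissible.twist_comp_smul (h : D.IsHeckeAdmissible g) (γ : ↥D.Γ) :
    h.twist.comp ⟨fun e : D.LevelCover (D.heckeLevel g) => (QuotientGroup.mk γ : ↥D.Γ ⧸ D.heckeLevel g) • e,
        continuous_const_smul _⟩ =
      D.coverMap (g * γ) (mul_mem h.mem_unitaryGroup (D.isCongruenceSubgroup.1 γ.2)) (fun δ hδ => by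
        have h' := D.conj_mem_of_mem_heckeLevel g
          (Subgroup.Normal.conj_mem inferInstance δ hδ γ : γ * δ * γ⁻¹ ∈ D.heckeLevel g)
        simpa only [Subgroup.coe_mul, InvMemClass.coe_inv, mul_assoc, _root_.mul_inv_rev] using h') :=
  D.coverMap_comp_smul (D.heckeLevel g) g h.mem_unitaryGroup _ γ

/-- **Hecke operators preserve rational classes**: `T_g` is `[Γ' : N_g]⁻¹ ∈ ℚ` times the transfer of
a pull-back, and both are defined over `ℚ` (Hecke correspondences act on `Hᵏ(X(ℂ); ℚ)`; BMM Part 2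
§1.9, Thm. 61: `W([π_f])^K` is a `ℚ`-sub-Hodge structure).
[cite: BergeronMillsonMoeglin2016Balls, Part 2 §1.9 and Thm. 61] [cite: HatcherAT2002, §3.G p. 321] -/
theorem isRationalClass_heckeCorrespondenceAction (k : ℕ) (g : GL (Fin (p + 1)) D.E)
    {x : complexBetti X k} (hx : IsRationalClass x) :
    IsRationalClass (D.heckeCorrespondenceAction k g x) := by
  by_cases h : D.IsHeckeAdmissible g
  · haveI : (D.heckeLevel g).FiniteIndex := h.finiteIndex
    letI : Fintype (↥D.Γ ⧸ D.heckeLevel g) := Subgroup.fintypeQuotientOfFiniteIndex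
    rw [D.heckeCorrespondenceAction_apply h k x]
    dsimp only
    have e : ((D.heckeIndex g : ℂ)⁻¹) = (((D.heckeIndex g : ℚ)⁻¹ : ℚ) : ℂ) := by
      push_cast
      rfl
    rw [e]
    exact ((hx.map _).transferMap _).smul _
  · rw [D.heckeCorrespondenceAction_of_not h]
    exact IsRationalClass.zero

end Hecke

end UnitaryBallQuotientDatum

end Literature.AlgebraicGeometry.ShimuraVarieties

end
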